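import Literature.RingTheory.CohomologyAnnihilator.NoetherDifferentAnnihilator
import Summits.ResolutionOfSingularities.ResolutionOfSingularities.Theorems.HomologicalConductorNoZenoRTorsionFreeTwoTerm
import Mathlib.Algebra.Category.ModuleCat.ChangeOfRings
import Mathlib.Algebra.Category.ModuleCat.EnoughInjectives
import Mathlib.CategoryTheory.Abelian.Projective.Dimension
import Mathlib.LinearAlgebra.Pi
import HarnessLib

/-!
# Crux `NoZenoR` (stmt-ResolutionOfSingularities-19943), W3 print `jacobianFloorNN_normal_dim3` —
# the noether different annihilates `Ext` beyond the flat case: torsion-free algebras of projective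
# dimension `≤ 1` (the mechanism of Iyengar–Takahashi 2016, Thm 3.8, without DG algebras)

Route `ResolutionOfSingularities/HomologicalConductor` (cell decomp-res, hand leafhand-res-homologicalconduct-16 g1).
OURS: AI-written support lemmas, weaker than expert review; nothing here is a statement of the manuscript
under review (Hironaka 2017), and nothing here is a NAMED FACT.  SUPPORT level, counted 0.  Def-free.

[IyengarTakahashi2016, Thm 3.8]: for a noetherian
ring `R` of dimension `d`, equidimensional with `2·depth R_𝔭 ≥ dim R_𝔭`, `jac(R) · Ext^{d+1}_R(−,−) = 0`;
the printed proof passes through the DERIVED noether different (§2 loc. cit.).  For a Noether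
normalisation `A → B` with `pd_A B ≤ 1 ≤ d/2` and `B` torsion-free over the domain `A` (e.g. a normal
domain of dimension `3` over a regular `A`) we PROVE the conclusion `𝔑(B/A) ⊆ caᵈ⁺¹(B)` by elementary
homological algebra (OUR proof; the statement is the `𝔑`-form of Thm 3.8 in this case, cf. Lemma 2.1 +
Thm 2.3 loc. cit.):

(Homological lemmas — `Hom_A(P, I)` injective, `Tor₁`-vanishing for torsion-free modules, `Ext` into
modules of injective dimension `≤ 1` — in the sibling `HomologicalConductorNoZenoRTorsionFreeTwoTerm.lean`.)
Consumed by `HomologicalConductorNoZenoRJacobianFloorNormal.lean`: the W3 print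
`Literature.RingTheory.CohomologyAnnihilator.jacobianFloorNN_normal_dim3` (normal domains of dimension `3`
have `pd ≤ 1` over a Noether normalisation, being reflexive).
* `exists_injective_acyclic_embedding` — if `0 → P₁ → P₀ → B → 0` is a flat two-term resolution over
  `A`, every `B`-module embeds in an injective `B`-module `E = Hom_A(B, I)` with `Ext^{≥1}_A(K, E) = 0`
  for every `B`-module `K` torsion-free over `A`;
* `noetherDifferent_smul_ext_eq_zero_of_acyclic` — cosyzygy induction from Lemma 3.2 of
  [IyengarTakahashi2014] (tree `noetherDifferent_mul_smul_ext_eq_zero`): `x ∈ 𝔑(B/A)` kills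
  `Extʲ_B(K, N)` whenever `Extʲ_A(K, N) = 0`;
* `noetherDifferent_le_cohomologyAnnihilatorOfDegree_of_hasProjectiveDimensionLT_two` — **`𝔑(B/A) ⊆
  caᵈ⁺¹(B)`** for `A` a noetherian domain with `caᵈ⁺¹(A) = A`, `d ≥ 2`, `B` module-finite and
  torsion-free over `A` with `pd_A B ≤ 1` (first syzygies over `B` are torsion-free of `pd_A ≤ d − 1`).

## References

* S. B. Iyengar, R. Takahashi, *The Jacobian ideal of a commutative ring and annihilators of
  cohomology*, J. Algebra 2021; arXiv:1610.02599 — Lemma 2.1, Thm 2.3, Lemma 3.7, Thm 3.8. [`IyengarTakahashi2016`]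
* S. B. Iyengar, R. Takahashi, *Annihilation of cohomology and strong generation of module
  categories*, IMRN 2016; arXiv:1404.1476 — Lemma 3.2. [`IyengarTakahashi2014`]
-/

noncomputable section

-- single-problem summit: the doubled namespace component `ResolutionOfSingularities` is forced
set_option linter.dupNamespace false

open CategoryTheory CategoryTheory.Abelian
open scoped TensorProduct

universe u

namespace Summit.ResolutionOfSingularities.ResolutionOfSingularities.Theorems.NoZeno.NoetherDifferentTorsionFree

open Literature.RingTheory.CohomologyAnnihilator TorsionFreeTwoTerm

/-! ## §1 The coinduced injectives `Hom_A(B, I)` and their `A`-acyclicity for torsion-free modules -/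

section Coinduced

variable {A : Type u} [CommRing A] {B : Type u} [CommRing B] [Algebra A B]

/-- **Acyclic injective embeddings.**  Let `A` be a domain and `B` an `A`-algebra whose underlying
`A`-module has a two-term flat resolution `0 → P₁ —ι→ P₀ —π→ B → 0`.  For a `B`-module `K` that is
TORSION-FREE over `A`, every `B`-module `N` embeds into an injective `B`-module `E` (the coinduced
module `Hom_A(B, I)`, `I ⊇ N` an injective `A`-module) with `Extʲ_A(K, E) = 0` for all `j ≥ 1`
(`Hom_A(B, I)` has the injective resolution `0 → Hom_A(B, I) → Hom_A(P₀, I) → Hom_A(P₁, I) → 0`, and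
`Ext¹` vanishes because `K ⊗ P₁ → K ⊗ P₀` is injective, `lTensor_injective_of_noZeroSMulDivisors`).
[folklore] -/
theorem exists_injective_acyclic_embedding [IsDomain A]
    {P₀ P₁ : Type u} [AddCommGroup P₀] [Module A P₀] [Module.Flat A P₀]
    [AddCommGroup P₁] [Module A P₁] [Module.Flat A P₁]
    (π : P₀ →ₗ[A] (restrictScalarsFunctor A B).obj (ModuleCat.of B B))
    (hπ : Function.Surjective π) (ι : P₁ →ₗ[A] P₀) (hι : Function.Injective ι)
    (hex : Function.Exact ι π)
    (K : ModuleCat.{u} B) [NoZeroSMulDivisors A ((restrictScalarsFunctor A B).obj K)]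
    (N : ModuleCat.{u} B) :
    ∃ (E : ModuleCat.{u} B) (i : N ⟶ E), Injective E ∧ Mono i ∧
      ∀ (j : ℕ) (e : Ext.{u} ((restrictScalarsFunctor A B).obj K)
        ((restrictScalarsFunctor A B).obj E) (j + 1)), e = 0 := by
  -- an injective `A`-module `I ⊇ N`
  let I : ModuleCat.{u} A := Injective.under ((restrictScalarsFunctor A B).obj N)
  let ιN : (restrictScalarsFunctor A B).obj N ⟶ I := Injective.ι _
  haveI : Mono ιN := inferInstance
  have hIobj : Injective I := inferInstance
  haveI : Injective (ModuleCat.of A I) := hIobj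
  haveI hIinj : Module.Injective A I :=
    Module.injective_module_of_injective_object (R := A) (M := I)
  -- the coinduced `B`-module `E = Hom_A(B, I)` and the embedding `N → E`
  let E : ModuleCat.{u} B := (ModuleCat.coextendScalars (algebraMap A B)).obj I
  let i : N ⟶ E := ModuleCat.RestrictionCoextensionAdj.HomEquiv.fromRestriction (algebraMap A B) ιN
  haveI : (restrictScalarsFunctor A B).PreservesMonomorphisms :=
    ⟨fun g hg => by rwa [ModuleCat.mono_iff_injective] at hg ⊢⟩
  have hEinj : Injective E :=
    Injective.injective_of_adjoint (ModuleCat.restrictCoextendScalarsAdj.{u} (algebraMap A B)) I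
  have hi : Mono i := by
    rw [ModuleCat.mono_iff_injective, injective_iff_map_eq_zero]
    intro y hy
    have h2 := ModuleCat.RestrictionCoextensionAdj.HomEquiv.fromRestriction_hom_apply_apply
      (algebraMap A B) ιN y (1 : B)
    rw [one_smul] at h2
    have hy' : ∀ s : B, (i.hom y) s = 0 := fun s => by rw [hy]; rfl
    have h1 : ιN.hom y = 0 := by
      rw [← h2]
      exact hy' 1
    exact (injective_iff_map_eq_zero _).mp ((ModuleCat.mono_iff_injective ιN).mp inferInstance) y h1
  refine ⟨E, i, hEinj, hi, ?_⟩
  -- the two-term injective resolution `0 → Hom_A(B, I) → Hom_A(P₀, I) → Hom_A(P₁, I) → 0` over `A`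
  haveI : Module.Injective A (P₀ →ₗ[A] I) := injective_linearMap_of_flat P₀ I
  haveI : Module.Injective A (P₁ →ₗ[A] I) := injective_linearMap_of_flat P₁ I
  letI : Module A E := Module.compHom E (algebraMap A B)
  let fT' : E →ₗ[A] (P₀ →ₗ[A] I) :=
    { toFun := fun g => (ModuleCat.CoextendScalars.equiv (algebraMap A B) I g) ∘ₗ π
      map_add' := fun g g' => by ext p; rfl
      map_smul' := fun a g => by
        ext p
        change (ModuleCat.CoextendScalars.equiv (algebraMap A B) I g)
            ((show B from π p) * algebraMap A B a) =
          a • (ModuleCat.CoextendScalars.equiv (algebraMap A B) I g) (π p)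
        rw [← LinearMap.map_smul]
        congr 1
        exact mul_comm (show B from π p) (algebraMap A B a) }
  let fT : (restrictScalarsFunctor A B).obj E ⟶ ModuleCat.of A (P₀ →ₗ[A] I) := ModuleCat.ofHom fT'
  let gT : ModuleCat.of A (P₀ →ₗ[A] I) ⟶ ModuleCat.of A (P₁ →ₗ[A] I) :=
    ModuleCat.ofHom (LinearMap.lcomp A I ι)
  have hfT : ∀ (g : (restrictScalarsFunctor A B).obj E) (p : P₀),
      fT.hom g p = (ModuleCat.CoextendScalars.equiv (algebraMap A B) I g) (π p) := fun _ _ => rfl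
  have hzero : fT ≫ gT = 0 := by
    ext g p
    change fT.hom g (ι p) = 0
    rw [hfT, hex.apply_apply_eq_zero, map_zero]
  have hT : (ShortComplex.mk fT gT hzero).ShortExact := by
    refine { exact := ?_, mono_f := ?_, epi_g := ?_ }
    · rw [ShortComplex.ShortExact.moduleCat_exact_iff_function_exact]
      intro h
      constructor
      · intro hh
        -- `h ∘ ι = 0`: `h` factors through `π`
        have hh' : ∀ q, h (ι q) = 0 := fun q => LinearMap.congr_fun hh q
        have hker : LinearMap.ker π ≤ LinearMap.ker h := by
          intro p hp
          obtain ⟨q, rfl⟩ := (hex p).mp hp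
          exact hh' q
        let g₀ : (restrictScalarsFunctor A B).obj (ModuleCat.of B B) →ₗ[A] I :=
          ((LinearMap.ker π).liftQ h hker) ∘ₗ (π.quotKerEquivOfSurjective hπ).symm.toLinearMap
        have hg₀ : ∀ p, g₀ (π p) = h p := fun p => by
          simp only [g₀, LinearMap.coe_comp, LinearEquiv.coe_coe, Function.comp_apply]
          rw [show (π.quotKerEquivOfSurjective hπ).symm (π p) = Submodule.Quotient.mk p from
            (LinearEquiv.symm_apply_eq _).mpr rfl]
          rfl
        refine ⟨(ModuleCat.CoextendScalars.equiv (algebraMap A B) I).symm g₀, ?_⟩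
        ext p
        change fT.hom _ p = h p
        rw [hfT, LinearEquiv.apply_symm_apply, hg₀]
      · rintro ⟨g, rfl⟩
        exact LinearMap.congr_fun (ModuleCat.hom_ext_iff.mp hzero) g
    · rw [ModuleCat.mono_iff_injective, injective_iff_map_eq_zero]
      intro g hg
      apply (ModuleCat.CoextendScalars.equiv (algebraMap A B) I).injective
      ext b
      obtain ⟨p, rfl⟩ := hπ b
      exact LinearMap.congr_fun hg p
    · rw [ModuleCat.epi_iff_surjective]
      intro h
      obtain ⟨h', hh'⟩ := Module.Injective.extension_property A I _ _ ι hι h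
      exact ⟨h', hh'⟩
  haveI : Injective (ShortComplex.mk fT gT hzero).X₂ :=
    Module.injective_object_of_injective_module (R := A) (M := P₀ →ₗ[A] I)
  haveI : Injective (ShortComplex.mk fT gT hzero).X₃ :=
    Module.injective_object_of_injective_module (R := A) (M := P₁ →ₗ[A] I)
  intro j e
  cases j with
  | succ j => exact ext_eq_zero_of_shortExact_of_injective hT ((restrictScalarsFunctor A B).obj K) j e
  | zero =>
    refine ext_one_eq_zero_of_shortExact_of_lift hT ((restrictScalarsFunctor A B).obj K)
      (fun φ => ?_) e
    -- lift `φ : K → Hom(P₁, I)` through `Hom(P₀, I)`: extend `K ⊗ P₁ → I` along `K ⊗ P₁ ↪ K ⊗ P₀`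
    letI : Module A K := Module.compHom K (algebraMap A B)
    haveI : NoZeroSMulDivisors A K := ‹NoZeroSMulDivisors A ((restrictScalarsFunctor A B).obj K)›
    have hm : Function.Injective (ι.lTensor K) := lTensor_injective_of_noZeroSMulDivisors K ι hι
    let φ' : K →ₗ[A] (P₁ →ₗ[A] I) := φ.hom
    obtain ⟨θ, hθ⟩ := Module.Injective.extension_property A I _ _ (ι.lTensor K) hm
      (TensorProduct.lift φ')
    refine ⟨ModuleCat.ofHom (X := K) (TensorProduct.curry θ), ?_⟩
    ext k p
    change θ (k ⊗ₜ ι p) = φ' k p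
    have := LinearMap.congr_fun hθ (k ⊗ₜ p)
    simpa using this

/-- **Cosyzygy induction.**  Let `x ∈ 𝔑(B/A)` and let `K` be a `B`-module such that every
`B`-module embeds into an injective `B`-module `E` with `Ext^{≥ 1}_A(K, E) = 0`.  Then for every
`j ≥ 1` and every `B`-module `N` with `Extʲ_A(K, N) = 0` one has `x · Extʲ_B(K, N) = 0`.  (Base case
`j = 1`: Lemma 3.2 of Iyengar–Takahashi 2014 / Wang; step: a cosyzygy `0 → N → E → N' → 0`, the
connecting maps being `B`-linear and `Extʲ⁻¹_A(K, N') ≅ Extʲ_A(K, N)`.)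
[cite: IyengarTakahashi2014, Lemma 3.2] -/
theorem noetherDifferent_smul_ext_eq_zero_of_acyclic (K : ModuleCat.{u} B)
    (hE : ∀ N : ModuleCat.{u} B, ∃ (E : ModuleCat.{u} B) (i : N ⟶ E), Injective E ∧ Mono i ∧
      ∀ (j : ℕ) (e : Ext.{u} ((restrictScalarsFunctor A B).obj K)
        ((restrictScalarsFunctor A B).obj E) (j + 1)), e = 0)
    {x : B} (hx : x ∈ noetherDifferent A B) :
    ∀ (j : ℕ) (N : ModuleCat.{u} B),
      (∀ e : Ext.{u} ((restrictScalarsFunctor A B).obj K) ((restrictScalarsFunctor A B).obj N)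
        (j + 1), e = 0) → ∀ e : Ext.{u} K N (j + 1), x • e = 0 := by
  intro j
  induction j with
  | zero =>
    intro N hA e
    have h := noetherDifferent_mul_smul_ext_eq_zero K N hx (a := 1)
      (fun e' => by rw [hA e', smul_zero]) e
    simpa using h
  | succ j ih =>
    intro N hA e
    obtain ⟨E, i, hEinj, hi, hEac⟩ := hE N
    haveI := hEinj
    haveI := hi
    have hS : (ShortComplex.mk i (Limits.cokernel.π i) (Limits.cokernel.condition i)).ShortExact :=
      { exact := ShortComplex.exact_cokernel i }
    -- over `B`: `e = x₃ ∘ δ` with `x₃ ∈ Extʲ⁺¹_B(K, N')`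
    have h1 : e.comp (Ext.mk₀ i) (add_zero _) = 0 := Ext.eq_zero_of_injective _
    obtain ⟨x₃, rfl⟩ := Ext.covariant_sequence_exact₁ K hS e h1 (n₀ := j + 1) rfl
    have hx₃ : x • x₃ = 0 := by
      refine ih _ (fun e' => ?_) x₃
      -- over `A`: `Extʲ⁺¹_A(K, N') = 0` from `Extʲ⁺¹_A(K, E) = 0` and `Extʲ⁺²_A(K, N) = 0`
      have hSA := hS.map_of_exact (restrictScalarsFunctor A B)
      obtain ⟨x₂, rfl⟩ := Ext.covariant_sequence_exact₃ ((restrictScalarsFunctor A B).obj K) hSA e'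
        (n₁ := j + 2) rfl (hA _)
      rw [hEac j x₂]
      exact Ext.zero_comp _ _ _ _ _
    rw [← Ext.smul_comp, hx₃, Ext.zero_comp]

end Coinduced

/-! ## §2 The noether different lies in `caᵈ⁺¹(B)`: torsion-free algebras of projective dimension `≤ 1` -/

section Main

variable {A : Type u} [CommRing A] {B : Type u} [CommRing B] [Algebra A B]

/-- Restriction of scalars of a finite free module `Bⁿ` has projective dimension at most that of
`B` (induction along `0 → B → B × Bⁿ → Bⁿ → 0`). [folklore] -/
theorem hasProjectiveDimensionLT_restrictScalars_pi {m : ℕ}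
    (hB : HasProjectiveDimensionLT ((restrictScalarsFunctor A B).obj (ModuleCat.of B B)) m) (n : ℕ) :
    HasProjectiveDimensionLT ((restrictScalarsFunctor A B).obj (ModuleCat.of B (Fin n → B))) m := by
  induction n with
  | zero =>
    have hz : Limits.IsZero ((restrictScalarsFunctor A B).obj (ModuleCat.of B (Fin 0 → B))) :=
      (restrictScalarsFunctor A B).map_isZero (ModuleCat.isZero_of_subsingleton _)
    haveI := hz.hasProjectiveDimensionLT_zero
    exact hasProjectiveDimensionLT_of_ge _ 0 m (Nat.zero_le m)
  | succ n ih =>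
    let S : ShortComplex (ModuleCat.{u} B) :=
      ShortComplex.mk (ModuleCat.ofHom (LinearMap.inl B B (Fin n → B)))
        (ModuleCat.ofHom (LinearMap.snd B B (Fin n → B))) (by ext x; rfl)
    have hS : S.ShortExact :=
      { exact := (ShortComplex.ShortExact.moduleCat_exact_iff_function_exact S).mpr
          (fun y => ⟨fun hy => ⟨y.1, Prod.ext rfl (Eq.symm hy)⟩, by rintro ⟨a, rfl⟩; rfl⟩)
        mono_f := (ModuleCat.mono_iff_injective _).mpr LinearMap.inl_injective
        epi_g := (ModuleCat.epi_iff_surjective _).mpr LinearMap.snd_surjective }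
    have hSA := hS.map_of_exact (restrictScalarsFunctor A B)
    haveI : HasProjectiveDimensionLT
        ((restrictScalarsFunctor A B).obj (ModuleCat.of B (B × (Fin n → B)))) m :=
      hSA.hasProjectiveDimensionLT_X₂ m hB ih
    exact hasProjectiveDimensionLT_of_iso ((restrictScalarsFunctor A B).mapIso
      (Fin.consLinearEquiv B (fun _ : Fin (n + 1) => B)).toModuleIso) m

/-- **The noether different annihilates `Ext^{≥ d+1}` for torsion-free algebras of projective
dimension `≤ 1`** (Iyengar–Takahashi 2016, the mechanism of Thm 3.8 / Thm 1.2 for `2·pd_A B ≤ 2 ≤ d`,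
WITHOUT the derived noether different).  Let `A` be a noetherian domain with `caᵈ⁺¹(A) = A`
(`gldim A ≤ d` on finite modules), `d ≥ 2`, and `B` a module-finite `A`-algebra, torsion-free over
`A`, whose underlying `A`-module has projective dimension `≤ 1`.  Then `𝔑(B/A) ⊆ caᵈ⁺¹(B)`.
Proof: for finitely generated `B`-modules `M`, `N` and `i ≥ d + 1`, `Extⁱ_B(M, N) ≅ Extⁱ⁻¹_B(K, N)`
for the first syzygy `K ⊆ Bⁿ` of `M`, which is torsion-free over `A` with `pd_A K ≤ d - 1 ≤ i - 2`;
conclude by the cosyzygy induction `noetherDifferent_smul_ext_eq_zero_of_acyclic` and the acyclic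
injective embeddings `exists_injective_acyclic_embedding`.
[cite: IyengarTakahashi2016, Thm 3.8 (p.8) with Lemma 2.1, Thm 2.3] -/
theorem noetherDifferent_le_cohomologyAnnihilatorOfDegree_of_hasProjectiveDimensionLT_two
    [IsDomain A] [IsNoetherianRing A] [Module.Finite A B] [NoZeroSMulDivisors A B]
    (hpd : HasProjectiveDimensionLT ((restrictScalarsFunctor A B).obj (ModuleCat.of B B)) 2)
    {d : ℕ} (hd : 2 ≤ d) (hA : cohomologyAnnihilatorOfDegree A (d + 1) = ⊤) :
    noetherDifferent A B ≤ cohomologyAnnihilatorOfDegree B (d + 1) := by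
  intro x hx
  rw [mem_cohomologyAnnihilatorOfDegree_iff]
  intro i hi M N hM hN e
  -- a two-term projective resolution `0 → P₁ → Aᵐ → B → 0` of `B` over `A`
  haveI : Module.Finite A ((restrictScalarsFunctor A B).obj (ModuleCat.of B B)) :=
    finite_restrictScalars (ModuleCat.of B B)
  obtain ⟨m, π, hπ⟩ :=
    Module.Finite.exists_fin' A ((restrictScalarsFunctor A B).obj (ModuleCat.of B B))
  have hSπ := LinearMap.shortExact_shortComplexKer hπ
  haveI hK1 : HasProjectiveDimensionLT (ModuleCat.of A (LinearMap.ker π)) 1 :=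
    hSπ.hasProjectiveDimensionLT_X₁ 1 inferInstance hpd
  have : Projective (ModuleCat.of A (LinearMap.ker π)) := inferInstance
  haveI : Module.Projective A (LinearMap.ker π) :=
    (ModuleCat.of A (LinearMap.ker π)).projective_of_module_projective
  -- the first syzygy `K ⊆ Bⁿ` of `M` over `B`
  obtain ⟨n, s, hs⟩ := Module.Finite.exists_fin' B M
  have hSM := LinearMap.shortExact_shortComplexKer hs
  obtain ⟨j, rfl⟩ : ∃ j, i = j + 2 := ⟨i - 2, by omega⟩
  have he : (Ext.mk₀ (s.shortComplexKer).g).comp e (zero_add _) = 0 :=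
    Ext.eq_zero_of_projective _
  obtain ⟨x₁, rfl⟩ := Ext.contravariant_sequence_exact₃ hSM N e he (n₀ := j + 1) (by omega)
  rw [← Ext.comp_smul]
  let K : ModuleCat.{u} B := ModuleCat.of B (LinearMap.ker s)
  -- `K` is torsion-free over `A`
  haveI : NoZeroSMulDivisors A ((restrictScalarsFunctor A B).obj K) := by
    refine ⟨fun {a k} h => ?_⟩
    by_cases ha : a = 0
    · exact Or.inl ha
    right
    have h' : algebraMap A B a • (show LinearMap.ker s from k) = 0 := h
    apply Subtype.ext
    funext t
    have ht := congrArg (fun v : LinearMap.ker s => (v : Fin n → B) t) h'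
    simp only [SetLike.val_smul, Pi.smul_apply, smul_eq_mul, ZeroMemClass.coe_zero,
      Pi.zero_apply] at ht
    rw [← Algebra.smul_def] at ht
    exact (smul_eq_zero.mp ht).resolve_left ha
  have hK : x • x₁ = 0 := by
    refine noetherDifferent_smul_ext_eq_zero_of_acyclic K
      (fun N' => exists_injective_acyclic_embedding π hπ (LinearMap.ker π).subtype
        (LinearMap.ker π).injective_subtype (LinearMap.exact_subtype_ker_map π) K N')
      hx j N (fun e' => ?_) x₁
    -- `Ext_A(K, N) (j+1) = 0`: `pd_A K ≤ d - 1 ≤ j`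
    have hKd : HasProjectiveDimensionLT ((restrictScalarsFunctor A B).obj K) d := by
      have hSMA := hSM.map_of_exact (restrictScalarsFunctor A B)
      refine hSMA.hasProjectiveDimensionLT_X₁ d ?_ ?_
      · haveI := hasProjectiveDimensionLT_restrictScalars_pi hpd n
        exact hasProjectiveDimensionLT_of_ge
          ((restrictScalarsFunctor A B).obj (ModuleCat.of B (Fin n → B))) 2 d hd
      · haveI : Module.Finite A ((restrictScalarsFunctor A B).obj M) := finite_restrictScalars M
        exact hasProjectiveDimensionLT_of_cohomologyAnnihilatorOfDegree_eq_top hA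
          ((restrictScalarsFunctor A B).obj M)
    exact e'.eq_zero_of_hasProjectiveDimensionLT d (by omega)
  rw [hK, Ext.comp_zero]

end Main

end Summit.ResolutionOfSingularities.ResolutionOfSingularities.Theorems.NoZeno.NoetherDifferentTorsionFree

end
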